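import Summits.Parity.GeneralizedHardyLittlewood.Theorems.Dhl42ChainCriterion
import Summits.Parity.GeneralizedHardyLittlewood.Theorems.Dhl42BigU

/-!
# DHL[42,2] certificate — Section 3 in multiset language: `B_V`, `U_V`, `𝒞_i(c;β)`, Lemma 3.2

§4 finite multisets of reals: `Bsum V u = B_V(u)`, `Usum V u = U_V(u)` (§1.5 Notation) with their
algebra, `bigU_eq_Usum` (the Part-5 `U_t` is `U` of the coordinate multiset),
`CondC i c β V = 𝒞_i(c;β)` (3.2), `IsRefinement`, and **Lemma 3.2** in its three parts
(`CondC.of_isRefinement`, `CondC.of_delete`, `CondC.add_small`); §5 the logarithmic dictionary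
`logMultiset λ n = {λ log p : p ∣ n}` and Proposition 3.3 / Lemma 3.1 exactly as printed
(`denselyDivisible_of_condC`, `denselyDivisible_one_iff_condC`).

Origin: `Dhl42/ChainCriterion.lean` of the DHL[42,2] certificate package (pub-dhl42 bundle, archive
blob `18cce9e3`; sha256[:16] of the file `bb6c947b32a20c2a`; paper snapshot = `paper/main.tex` v1),
lines :266–:534; statements and proofs unchanged except: namespace `TpY4Dhl42` →
`Summit.Parity.GeneralizedHardyLittlewood.Theorems.Dhl42`, the package's `simplexSet n B` replaced
by the tree's definitionally equal `Literature.NumberTheory.Sieve.scaledSimplex n B` (also inside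
declaration names), docstrings added where missing, `#print axioms` lines dropped. Package-internal
references in the verbatim docstrings (`Dhl42/….lean`, `Assumed.…`, `row 9…`, `gen n`,
`inputs/COMPARE.md`) refer to that package (paper Appendix B).

Declarations (27): `Bsum`, `Usum`, `Bsum_add_Usum`, `bigU_eq_Usum`, `Bsum_zero`, `Bsum_cons`,
`Bsum_add`, `Bsum_nonneg`, `Bsum_le_sum`, `Bsum_eq_sum_of_forall_lt`, `Bsum_eq_of_gap`, `CondC`,
`CondC.mono`, `IsRefinement`, `CondC.refine_one`, `CondC.of_isRefinement`, `CondC.of_delete`,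
`CondC.add_small`, `Usum_add`, `Bsum_eq_sum_sub_Usum`, `CondC.of_Usum_le`, `logMultiset`,
`mem_logMultiset`, `logMultiset_nonneg`, `Bsum_logMultiset`, `denselyDivisible_of_condC`,
`denselyDivisible_one_iff_condC`.
-/

open Literature.NumberTheory.Sieve (DenselyDivisible)

namespace Summit.Parity.GeneralizedHardyLittlewood.Theorems.Dhl42

/-! ### §4. Finite multisets of reals: `B_V`, `U_V`, the condition `𝒞_i(c;β)`, and Lemma 3.2 -/

/-- `B_V(u) = Σ_{v ∈ V, v < u} v` (paper, §1.5 Notation; copies of `u` itself are not counted). -/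
noncomputable def Bsum (V : Multiset ℝ) (u : ℝ) : ℝ := (V.filter (· < u)).sum

/-- `U_V(u) = Σ_{v ∈ V, v ≥ u} v = Σ V − B_V(u)`. -/
noncomputable def Usum (V : Multiset ℝ) (u : ℝ) : ℝ := (V.filter (u ≤ ·)).sum

/-- `B_V(u) + U_V(u) = Σ V` (every element is either `< u` or `≥ u`). -/
theorem Bsum_add_Usum (V : Multiset ℝ) (u : ℝ) : Bsum V u + Usum V u = V.sum := by
  unfold Bsum Usum
  conv_rhs => rw [← Multiset.filter_add_not (fun v => v < u) V]
  rw [Multiset.sum_add]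
  congr 2
  exact Multiset.filter_congr fun x _ => by simp [not_lt]

/-- The paper's `U_T` for a point `t ∈ [0,∞)^n` (`TpY4Dhl42.bigU`) is `Usum` of its coordinate
multiset; hence `B_T = Σ T − U_T` (`Bsum_add_Usum`), the identity used in the proof of Lemma 4.5. -/
theorem bigU_eq_Usum {n : ℕ} (t : Fin n → ℝ) (u : ℝ) :
    bigU t u = Usum (Finset.univ.val.map t) u := by
  unfold bigU Usum
  rw [Multiset.filter_map, ← Finset.sum_filter]
  simp [Finset.sum_eq_multiset_sum, Finset.filter_val]

/-- `B_∅(u) = 0`. -/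
theorem Bsum_zero (u : ℝ) : Bsum 0 u = 0 := by simp [Bsum]

/-- `B_{a ∷ V}(u) = (a if a < u, else 0) + B_V(u)`. -/
theorem Bsum_cons (a : ℝ) (V : Multiset ℝ) (u : ℝ) :
    Bsum (a ::ₘ V) u = (if a < u then a else 0) + Bsum V u := by
  unfold Bsum
  by_cases h : a < u
  · rw [Multiset.filter_cons_of_pos (p := fun x => x < u) V h, Multiset.sum_cons, if_pos h]
  · rw [Multiset.filter_cons_of_neg (p := fun x => x < u) V h, if_neg h, zero_add]

/-- `B` is additive in the multiset: `B_{V + W}(u) = B_V(u) + B_W(u)`. -/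
theorem Bsum_add (V W : Multiset ℝ) (u : ℝ) : Bsum (V + W) u = Bsum V u + Bsum W u := by
  simp [Bsum, Multiset.filter_add, Multiset.sum_add]

/-- `B_W(u) ≥ 0` for a multiset `W` of non-negative reals. -/
theorem Bsum_nonneg {W : Multiset ℝ} (hW : ∀ x ∈ W, 0 ≤ x) (u : ℝ) : 0 ≤ Bsum W u :=
  Multiset.sum_nonneg fun x hx => hW x (Multiset.mem_of_mem_filter hx)

/-- `B_W(u) ≤ Σ W` for a multiset `W` of non-negative reals. -/
theorem Bsum_le_sum {W : Multiset ℝ} (hW : ∀ x ∈ W, 0 ≤ x) (u : ℝ) : Bsum W u ≤ W.sum := by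
  rw [← Bsum_add_Usum W u]
  have : 0 ≤ Usum W u := Multiset.sum_nonneg fun x hx => hW x (Multiset.mem_of_mem_filter hx)
  linarith

/-- If every element of `W` is `< u`, then `B_W(u) = Σ W`. -/
theorem Bsum_eq_sum_of_forall_lt {W : Multiset ℝ} {u : ℝ} (hW : ∀ x ∈ W, x < u) :
    Bsum W u = W.sum := by
  rw [Bsum, Multiset.filter_eq_self.2 hW]

/-- If no element of `V` lies in `[u, w)` (`u ≤ w`), then `B_V(w) = B_V(u)`. -/
theorem Bsum_eq_of_gap {V : Multiset ℝ} {u w : ℝ} (huw : u ≤ w)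
    (h : ∀ x ∈ V, x < w → x < u) : Bsum V w = Bsum V u := by
  unfold Bsum
  rw [Multiset.filter_congr fun x hx => ⟨h x hx, fun hxu => lt_of_lt_of_le hxu huw⟩]

/-- The condition `𝒞_i(c;β)` of the paper, (3.2): `B_V(v) ≥ i v − c + β` for every element `v`
of `V` with `v > c`. -/
def CondC (i : ℕ) (c β : ℝ) (V : Multiset ℝ) : Prop :=
  ∀ v ∈ V, c < v → (i : ℝ) * v - c + β ≤ Bsum V v

/-- `𝒞_i(c;β)` is antitone in `β`: `𝒞_i(c;β)` implies `𝒞_i(c;β')` for `β' ≤ β`. -/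
theorem CondC.mono {i : ℕ} {c β β' : ℝ} {V : Multiset ℝ} (h : CondC i c β V) (hβ : β' ≤ β) :
    CondC i c β' V := fun v hv hcv => by have := h v hv hcv; linarith

/-- `V'` is a **refinement** of `V` (paper, before Lemma 3.2): each element `w` of `V` is replaced by
a finite (possibly empty) multiset of non-negative reals with sum `w`.  Encoded by the multiset `P`
of the replacing blocks: `V = P.map Σ` and `V' = ⋃ P`. -/
def IsRefinement (V' V : Multiset ℝ) : Prop :=
  ∃ P : Multiset (Multiset ℝ),
    (∀ W ∈ P, ∀ x ∈ W, 0 ≤ x) ∧ P.map Multiset.sum = V ∧ P.join = V'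

/-- Lemma 3.2(a), one block: replacing a single element `w` of `V = w :: V₀` by a multiset `W` of
non-negative reals with `Σ W = w` preserves `𝒞_i(c;β)`.  This is the paper's argument verbatim
(old elements: `B` does not decrease; a new element `w_σ > c`: compare with `B_V(w)` if `V₀` has no
element in `[w_σ, w)`, else with `B_V(v)` for the least such element `v`). -/
theorem CondC.refine_one {i : ℕ} {c β w : ℝ} {V₀ W : Multiset ℝ}
    (hV : CondC i c β (w ::ₘ V₀)) (hW0 : ∀ x ∈ W, 0 ≤ x) (hWs : W.sum = w) :
    CondC i c β (W + V₀) := by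
  classical
  intro u hu hcu
  rw [Bsum_add]
  have hBW : 0 ≤ Bsum W u := Bsum_nonneg hW0 u
  rcases Multiset.mem_add.1 hu with huW | huV
  · -- `u = w_σ` is one of the new elements
    have huw : u ≤ w := hWs ▸ Multiset.single_le_sum hW0 u huW
    have hcw : c < w := lt_of_lt_of_le hcu huw
    have hiuw : (i : ℝ) * u ≤ i * w := by gcongr
    by_cases hex : ∃ x ∈ V₀, u ≤ x ∧ x < w
    · -- the least element `v` of `V₀` in `[u, w)`
      set s : Finset ℝ := (V₀.filter fun x => u ≤ x ∧ x < w).toFinset with hs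
      have hsne : s.Nonempty := by
        obtain ⟨x, hx, hux, hxw⟩ := hex
        exact ⟨x, by rw [hs, Multiset.mem_toFinset, Multiset.mem_filter]; exact ⟨hx, hux, hxw⟩⟩
      set v := s.min' hsne with hv
      have hvs : v ∈ s := Finset.min'_mem s hsne
      rw [hs, Multiset.mem_toFinset, Multiset.mem_filter] at hvs
      obtain ⟨hvV, huv, hvw⟩ := hvs
      have hcv : c < v := lt_of_lt_of_le hcu huv
      have hBv : (i : ℝ) * v - c + β ≤ Bsum V₀ v := by
        have := hV v (Multiset.mem_cons_of_mem hvV) hcv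
        rwa [Bsum_cons, if_neg (not_lt.2 hvw.le), zero_add] at this
      have hgap : Bsum V₀ v = Bsum V₀ u := by
        refine Bsum_eq_of_gap huv fun x hx hxv => ?_
        by_contra hxu
        push Not at hxu
        have hxs : x ∈ s := by
          rw [hs, Multiset.mem_toFinset, Multiset.mem_filter]
          exact ⟨hx, hxu, lt_trans hxv hvw⟩
        exact absurd (Finset.min'_le s x hxs) (not_le.2 (hv ▸ hxv))
      have hiuv : (i : ℝ) * u ≤ i * v := by gcongr
      linarith
    · have hgap : Bsum V₀ w = Bsum V₀ u := by
        refine Bsum_eq_of_gap huw fun x hx hxw => ?_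
        by_contra hxu
        push Not at hxu
        exact hex ⟨x, hx, hxu, hxw⟩
      have hBw : (i : ℝ) * w - c + β ≤ Bsum V₀ w := by
        have := hV w (Multiset.mem_cons_self w V₀) hcw
        rwa [Bsum_cons, if_neg (lt_irrefl w), zero_add] at this
      linarith
  · -- `u` is an old element
    have := hV u (Multiset.mem_cons_of_mem huV) hcu
    rw [Bsum_cons] at this
    have hle : (if w < u then w else 0) ≤ Bsum W u := by
      split_ifs with hwu
      · rw [Bsum_eq_sum_of_forall_lt fun x hx =>
          lt_of_le_of_lt (hWs ▸ Multiset.single_le_sum hW0 x hx) hwu, hWs]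
      · exact hBW
    linarith

/-- **Lemma 3.2(a).**  Every refinement of `V` satisfies `𝒞_i(c;β)` if `V` does. -/
theorem CondC.of_isRefinement {i : ℕ} {c β : ℝ} {V V' : Multiset ℝ} (hV : CondC i c β V)
    (h : IsRefinement V' V) : CondC i c β V' := by
  obtain ⟨P, hP0, rfl, rfl⟩ := h
  suffices H : ∀ (P : Multiset (Multiset ℝ)) (E : Multiset ℝ), (∀ W ∈ P, ∀ x ∈ W, 0 ≤ x) →
      CondC i c β (P.map Multiset.sum + E) → CondC i c β (P.join + E) by
    simpa using H P 0 hP0 (by simpa using hV)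
  intro P
  induction P using Multiset.induction_on with
  | empty => intro E _ h; simpa using h
  | cons W P ih =>
    intro E hP0 h
    rw [Multiset.map_cons, Multiset.cons_add] at h
    have h1 : CondC i c β (W + (P.map Multiset.sum + E)) :=
      CondC.refine_one h (hP0 W (Multiset.mem_cons_self _ _)) rfl
    rw [← add_assoc, add_comm W, add_assoc] at h1
    have h3 := ih (W + E) (fun W' hW' => hP0 W' (Multiset.mem_cons_of_mem hW')) h1
    rw [Multiset.join_cons]
    rwa [← add_assoc, add_comm P.join W] at h3

/-- **Lemma 3.2(b).**  Deleting from `V` a sub-multiset `D` of non-negative reals of total sum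
`Σ D` turns `𝒞_i(c;β)` into `𝒞_i(c;β − Σ D)`. -/
theorem CondC.of_delete {i : ℕ} {c β : ℝ} {V'' D : Multiset ℝ} (hV : CondC i c β (V'' + D))
    (hD0 : ∀ x ∈ D, 0 ≤ x) : CondC i c (β - D.sum) V'' := by
  intro u hu hcu
  have := hV u (Multiset.mem_add.2 (Or.inl hu)) hcu
  rw [Bsum_add] at this
  have hle : Bsum D u ≤ D.sum := Bsum_le_sum hD0 u
  linarith

/-- **Lemma 3.2(c).**  Adding non-negative elements `≤ c` preserves `𝒞_i(c;β)`. -/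
theorem CondC.add_small {i : ℕ} {c β : ℝ} {V E : Multiset ℝ} (hV : CondC i c β V)
    (hE0 : ∀ x ∈ E, 0 ≤ x) (hEc : ∀ x ∈ E, x ≤ c) : CondC i c β (V + E) := by
  intro u hu hcu
  rcases Multiset.mem_add.1 hu with huV | huE
  · rw [Bsum_add]
    have := hV u huV hcu
    have := Bsum_nonneg hE0 u
    linarith
  · exact absurd (hEc u huE) (not_le.2 hcu)

/-- `U` is additive in the multiset: `U_{V + W}(u) = U_V(u) + U_W(u)`. -/
theorem Usum_add (V W : Multiset ℝ) (u : ℝ) : Usum (V + W) u = Usum V u + Usum W u := by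
  simp [Usum, Multiset.filter_add, Multiset.sum_add]

/-- `B_V(u) = Σ V − U_V(u)`. -/
theorem Bsum_eq_sum_sub_Usum (V : Multiset ℝ) (u : ℝ) : Bsum V u = V.sum - Usum V u := by
  rw [← Bsum_add_Usum V u]; ring

/-- The step "(using `B = Σ − U` on each of `T, T'`)" in the proof of Lemma 4.5: an upper bound
`U_V(v) ≤ L + c − i v − ϱ` for the elements `v > c` of `V` (the active grade clause of the pair
condition `PC_ϱ`, Definition 4.1, with `V = T ⊎ T'`, `U_V = U_T + U_{T'}` by `Usum_add`) is the
condition `𝒞_i(c; ϱ + Σ V − L)`. -/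
theorem CondC.of_Usum_le {i : ℕ} {c ϱ L : ℝ} {V : Multiset ℝ}
    (h : ∀ v ∈ V, c < v → Usum V v ≤ L + c - i * v - ϱ) : CondC i c (ϱ + V.sum - L) V := by
  intro v hv hcv
  rw [Bsum_eq_sum_sub_Usum]
  have := h v hv hcv
  linarith

/-! ### §5. The logarithmic dictionary: Proposition 3.3 and Lemma 3.1 as printed -/

/-- `V = {λ log p : p ∣ n prime}` (a multiset without repetitions). -/
noncomputable def logMultiset (lam : ℝ) (n : ℕ) : Multiset ℝ :=
  n.primeFactors.val.map fun p : ℕ => lam * Real.log p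

/-- Membership in `logMultiset λ n`: its elements are exactly the numbers `λ log p`, `p ∣ n` prime.
-/
theorem mem_logMultiset {lam : ℝ} {n : ℕ} {v : ℝ} :
    v ∈ logMultiset lam n ↔ ∃ p ∈ n.primeFactors, lam * Real.log p = v := by
  simp [logMultiset]

/-- For `λ ≥ 0` every element of `logMultiset λ n` is non-negative (`log p ≥ 0`). -/
theorem logMultiset_nonneg {lam : ℝ} (hlam : 0 ≤ lam) {n : ℕ} :
    ∀ v ∈ logMultiset lam n, 0 ≤ v := by
  intro v hv
  obtain ⟨p, hp, rfl⟩ := mem_logMultiset.1 hv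
  exact mul_nonneg hlam (Real.log_nonneg (by exact_mod_cast (Nat.pos_of_mem_primeFactors hp)))

/-- `B_V(λ log p) = λ log ∏_{q ∣ n, q < p} q` for `V = {λ log q : q ∣ n}` and `λ > 0`. -/
theorem Bsum_logMultiset {lam : ℝ} (hlam : 0 < lam) (n : ℕ) {p : ℕ} (hp : p ∈ n.primeFactors) :
    Bsum (logMultiset lam n) (lam * Real.log p) =
      lam * Real.log (∏ q ∈ n.primeFactors.filter (· < p), (q : ℝ)) := by
  unfold Bsum logMultiset
  rw [Multiset.filter_map]
  have hp0 : (0 : ℝ) < p := by exact_mod_cast Nat.pos_of_mem_primeFactors hp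
  have hcongr : Multiset.filter ((fun x => x < lam * Real.log (p : ℝ)) ∘ fun q : ℕ => lam * Real.log (q : ℝ))
      n.primeFactors.val = (n.primeFactors.filter (· < p)).val := by
    rw [Finset.filter_val]
    refine Multiset.filter_congr fun q hq => ?_
    have hq0 : (0 : ℝ) < q := by exact_mod_cast Nat.pos_of_mem_primeFactors hq
    show lam * Real.log q < lam * Real.log p ↔ q < p
    rw [mul_lt_mul_iff_right₀ hlam, Real.log_lt_log_iff hq0 hp0, Nat.cast_lt]
  rw [hcongr, Real.log_prod]
  · rw [Finset.mul_sum]; rfl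
  · intro q hq
    exact_mod_cast (Nat.pos_of_mem_primeFactors (Finset.mem_filter.1 hq).1).ne'

/-- **Proposition 3.3 (as printed).**  `i ≥ 1`... in fact any `i ≥ 0`; `y ≥ 1`, `λ > 0`,
`c = λ log y`, `n` squarefree, and `V = {λ log p : p ∣ n}` satisfies `𝒞_i(c;0)`, i.e.
`B_V(v) ≥ i v − c` for all `v ∈ V` with `v > c`.  Then `n ∈ 𝒟^{(i)}(y)`. -/
theorem denselyDivisible_of_condC {y lam : ℝ} (hy : 1 ≤ y) (hlam : 0 < lam) (i : ℕ) {n : ℕ}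
    (hn : Squarefree n) (hC : CondC i (lam * Real.log y) 0 (logMultiset lam n)) :
    DenselyDivisible y i n := by
  apply denselyDivisible_of_chain hy i hn
  intro p hp hyp
  have hp0 : (0 : ℝ) < p := by exact_mod_cast Nat.pos_of_mem_primeFactors hp
  have hy0 : (0 : ℝ) < y := by linarith
  have hv : lam * Real.log y < lam * Real.log p := by
    rw [mul_lt_mul_iff_right₀ hlam]; exact Real.log_lt_log hy0 hyp
  have hmem : lam * Real.log p ∈ logMultiset lam n := mem_logMultiset.2 ⟨p, hp, rfl⟩
  have := hC _ hmem hv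
  rw [Bsum_logMultiset hlam n hp, add_zero] at this
  set P := ∏ q ∈ n.primeFactors.filter (· < p), (q : ℝ) with hP
  have hP0 : 0 < P :=
    Finset.prod_pos fun q hq => by exact_mod_cast Nat.pos_of_mem_primeFactors (Finset.mem_filter.1 hq).1
  have hring : lam * ((i : ℝ) * Real.log p - Real.log y) = (i : ℝ) * (lam * Real.log p) - lam * Real.log y := by
    ring
  have h1 : (i : ℝ) * Real.log p - Real.log y ≤ Real.log P := by
    refine le_of_mul_le_mul_left ?_ hlam
    linarith
  have h2 : Real.log ((p : ℝ) ^ i) ≤ Real.log (y * P) := by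
    rw [Real.log_pow, Real.log_mul hy0.ne' hP0.ne']
    linarith
  exact (Real.log_le_log_iff (pow_pos hp0 i) (mul_pos hy0 hP0)).1 h2

/-- **Lemma 3.1, logarithmic form** ("Equivalently, …"): for `λ > 0`, `V = {λ log p : p ∣ n}`,
`c = λ log y`, the squarefree `n` is `y`-densely divisible iff every `v ∈ V` with `v > c` satisfies
`B_V(v) ≥ v − c`. -/
theorem denselyDivisible_one_iff_condC {y lam : ℝ} (hy : 1 ≤ y) (hlam : 0 < lam) {n : ℕ}
    (hn : Squarefree n) :
    DenselyDivisible y 1 n ↔ CondC 1 (lam * Real.log y) 0 (logMultiset lam n) := by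
  refine ⟨fun hd => ?_, denselyDivisible_of_condC hy hlam 1 hn⟩
  have hch := chain_of_denselyDivisible_one hy hn hd
  intro v hv _
  obtain ⟨p, hp, rfl⟩ := mem_logMultiset.1 hv
  rw [Bsum_logMultiset hlam n hp, Nat.cast_one, one_mul, add_zero]
  have hp0 : (0 : ℝ) < p := by exact_mod_cast Nat.pos_of_mem_primeFactors hp
  have hy0 : (0 : ℝ) < y := by linarith
  set P := ∏ q ∈ n.primeFactors.filter (· < p), (q : ℝ) with hP
  have hP0 : 0 < P :=
    Finset.prod_pos fun q hq => by exact_mod_cast Nat.pos_of_mem_primeFactors (Finset.mem_filter.1 hq).1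
  have h1 : Real.log p ≤ Real.log y + Real.log P := by
    rw [← Real.log_mul hy0.ne' hP0.ne']
    exact Real.log_le_log hp0 (hch p hp)
  nlinarith

end Summit.Parity.GeneralizedHardyLittlewood.Theorems.Dhl42
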